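import Literature.NumberTheory.LFunctions.WeilTwoPrimePos59Def
import Literature.NumberTheory.LFunctions.WeilTwoPrimeOddMarginEDataP6
import Literature.NumberTheory.LFunctions.WeilBlockRowsPZ
import Literature.NumberTheory.LFunctions.WeilTwoPrimeOddMarginEDataDn2
import HarnessLib

/-!
# Two-prime positivity certificate (a₀ = 59/100): Bessel block claim `C H Cᵀ`, block 1, rows 35–39

Kernel facts by `decide +kernel`, one declaration per row. Pure proof file.
-/

noncomputable section

namespace Literature.NumberTheory.LFunctions

set_option maxHeartbeats 0 in
/-- Bessel block claim `C H Cᵀ`, block 1, row 35 (positivity certificate). [folklore] -/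
theorem checkHpRow1_35_weilCert23P : weilCert23PBase.checkHpRow weilCert23EHp 1 35 = true := by
  decide +kernel

set_option maxHeartbeats 0 in
/-- Bessel block claim `C H Cᵀ`, block 1, row 36 (positivity certificate). [folklore] -/
theorem checkHpRow1_36_weilCert23P : weilCert23PBase.checkHpRow weilCert23EHp 1 36 = true := by
  decide +kernel

set_option maxHeartbeats 0 in
/-- Bessel block claim `C H Cᵀ`, block 1, row 37 (positivity certificate). [folklore] -/
theorem checkHpRow1_37_weilCert23P : weilCert23PBase.checkHpRow weilCert23EHp 1 37 = true := by
  decide +kernel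

set_option maxHeartbeats 0 in
/-- Bessel block claim `C H Cᵀ`, block 1, row 38 (positivity certificate). [folklore] -/
theorem checkHpRow1_38_weilCert23P : weilCert23PBase.checkHpRow weilCert23EHp 1 38 = true := by
  decide +kernel

set_option maxHeartbeats 0 in
/-- Bessel block claim `C H Cᵀ`, block 1, row 39 (positivity certificate). [folklore] -/
theorem checkHpRow1_39_weilCert23P : weilCert23PBase.checkHpRow weilCert23EHp 1 39 = true := by
  decide +kernel


end Literature.NumberTheory.LFunctions
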